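import Mathlib
import HarnessLib
import Summits.Ventures.LatticeQCDFlow.Scoring.SplitChainTourIID
import Summits.Ventures.LatticeQCDFlow.Scoring.TourVarianceGeneral
import Summits.Ventures.LatticeQCDFlow.Scoring.RegenerativeTourCovarianceSq
import Summits.Ventures.LatticeQCDFlow.Scoring.RegenerativeEstimatorSharp
import Summits.Ventures.LatticeQCDFlow.Scoring.RegenerativeEstimatorSigma

/-!
# The regenerative estimator obeys the central limit theorem, from any start, with the
# Green–Kubo asymptotic variance: `√R (Â_R − π(f)) ⇒ N(0, ε σ²_f)`

HONEST FRAMING: exact (Metropolis-corrected) sampling algorithms for lattice gauge theory;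
figures of merit are autocorrelation/cost numbers at stated couplings and volumes; no
continuum-physics claim.

Venture `LatticeQCDFlow` (cell pub-lqcd), topic `Scoring`; FANOUT row 8 (`s0-cpn-nemc`, GEN-18).
NEW WORK of the cell, not a published result; no definition is introduced.  Notation of
`Scoring/RegenerativeEstimator.lean`: `π` invariant for `κ`, `κ(x, ·) ≥ ε ν` with `0 < ε < 1`,
`|f| ≤ C` measurable, `c = π(f)`, split chain `P̂` from ANY initial law; tours `1, …, R` with sums
`Y_i`, lengths `N_i`, centred sums `Z_i = S^{f − c}_i`; the regenerative (tour) estimator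
`Â_R = Σ_{i=1}^R Y_i / Σ_{i=1}^R N_i`; `e = ε.toReal`;
`σ²_f = ∫ f̄² dπ + 2 ∑' k, ∫ f̄ (kop κ)^[k+1] f̄ dπ` the Green–Kubo asymptotic variance.  The
CLT-free certificates of the row (`Scoring/RegenerativeEstimatorSigma.lean`: Chebyshev at the CLT
variance up to the factor `4`) are complemented here by the LIMIT THEOREM itself:
**`√R · (Â_R − π(f))` converges in distribution to the centred Gaussian of variance `e · σ²_f`**,
from any initial law — so the regenerative confidence intervals of Mykland–Tierney–Yu are
asymptotically exact, and their width is governed by the same `σ²_f` as the `τ_int`-based error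
bars.  (With `n ≈ R/e` samples this is the familiar `√n (Â − π f) ⇒ N(0, σ²_f)`.)  Ingredients, all
on the tree or in Mathlib: the tour pairs `(Z_{i+1}, N_{i+1})` are i.i.d. (`Scoring/SplitChainTourIID.lean`);
`E[Z_1] = 0` (cycle formula), `E[Z_1²] = v = E_ν̂[Z_0²]` with `e v = σ²_f`
(`Scoring/TourVarianceGeneral.lean`); Mathlib's central limit theorem
(`ProbabilityTheory.tendstoInDistribution_inv_sqrt_mul_sum_sub`) for `Σ Z_{i+1}/√R`; Mathlib's strong
law (`ProbabilityTheory.strong_law_ae_real`) for `Σ N_{i+1}/R → 1/e`; Slutsky's theorem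
(`MeasureTheory.TendstoInDistribution.continuous_comp_prodMk_of_tendstoInMeasure_const`) with the
continuous map `(a, w) ↦ a / max(w, 1)` (tour lengths are `≥ 1`, so `max` is inactive almost
surely); and the pathwise identity `√R (Â_R − c) = (Σ Z_{i+1}/√R) / (Σ N_{i+1}/R)`.  Printed
counterpart NAMED ONLY: the regenerative CLT for Markov chain Monte Carlo (Mykland–Tierney–Yu 1995
§3; Hobert–Jones–Presnell–Rosenthal 2002 Thm 2; Meyn–Tweedie 1993 Thm 17.3.6) — nothing is cited
as a fact.

## Content (`π` invariant, `0 < ε < 1`, `|f| ≤ C` measurable, any initial law)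

* **`splitChain_tourLength_strongLaw`** — `Σ_{i<R} N_{i+1} / R → 1/e` almost surely;
* **`splitChain_centredTourSum_clt`** — `(√R)⁻¹ Σ_{i<R} Z_{i+1} ⇒ N(0, v)`, `v = E_ν̂[Z_0²] = σ²_f/e`,
  for any `Y` with that Gaussian law on any auxiliary probability space;
* **`regenerative_estimator_clt`** — for any `Y` with law `gaussianReal 0 (e σ²_f)`:
  `TendstoInDistribution (fun R x̂ => √R (Â_R x̂ − π f)) atTop Y`.

NOT CLAIMED: a rate (Berry–Esseen); a CLT in the number of SAMPLES `n` rather than tours `R`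
(random number of tours — needs Anscombe's theorem); unbounded `f`; `σ²_f > 0` (when `σ²_f = 0`
the limit is the point mass and the statement still holds); any `ε` of a concrete sampler.
-/

noncomputable section

namespace Summit.Ventures.LatticeQCDFlow.Scoring

open MeasureTheory ProbabilityTheory Filter Finset Preorder Literature.Probability.MarkovChains
open scoped ENNReal Topology

section CLT

variable {Ω : Type*} [MeasurableSpace Ω]
  {κ : Kernel Ω Ω} [IsMarkovKernel κ] {ν : Measure Ω} [IsProbabilityMeasure ν] {ε : ℝ≥0∞}
  {hmin : ∀ x {B : Set Ω}, MeasurableSet B → ε * ν B ≤ κ x B}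
  (κs : Kernel (Ω × Bool) (Ω × Bool)) [IsMarkovKernel κs]
  (μs : Measure (Ω × Bool)) [IsProbabilityMeasure μs]

/-- **STRONG LAW FOR THE TOUR LENGTHS**: `0 < ε < 1`, any initial law:
`Σ_{i<R} N_{i+1} / R → 1/e` almost surely (on average a tour carries `1/e` samples). -/
theorem splitChain_tourLength_strongLaw (hε0 : 0 < ε) (hε : ε < 1)
    (hκs : ∀ p, κs p = (ε • ν).map (fun y : Ω => (y, true))
      + ((1 - ε) • Doeblin.residualKernel κ ν ε hmin p.1).map (fun y : Ω => (y, false))) :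
    ∀ᵐ x ∂(Kernel.trajMeasure (X := fun _ : ℕ => Ω × Bool) μs
        (fun m : ℕ => κs.comap (fun h : (i : ↥(Finset.Iic m)) → Ω × Bool =>
          h ⟨m, Finset.mem_Iic.2 le_rfl⟩) (measurable_pi_apply _))),
      Tendsto (fun R : ℕ => (∑ i ∈ Finset.range R, ∑' u, (if (∑ s ∈ Finset.range u,
          (if (x (s + 1)).2 then (1 : ℕ) else 0)) = i + 1 then (1 : ℝ) else 0)) / R)
        atTop (𝓝 (1 / ε.toReal)) := by
  set P := Kernel.trajMeasure (X := fun _ : ℕ => Ω × Bool) μs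
      (fun m : ℕ => κs.comap (fun h : (i : ↥(Finset.Iic m)) → Ω × Bool =>
        h ⟨m, Finset.mem_Iic.2 le_rfl⟩) (measurable_pi_apply _)) with hP
  -- the tour lengths as the second coordinates of the i.i.d. tour pairs `(S^0_{i+1}, S^1_{i+1})`
  have hT := splitChain_tourPairs_iIndepFun κs μs (κ := κ) (ν := ν) (hmin := hmin) hε0 hε hκs
    (g₁ := fun _ => (0 : ℝ)) (g₂ := fun _ => (1 : ℝ)) measurable_const measurable_const
  have hTid := fun i => splitChain_tourPair_identDistrib κs μs (κ := κ) (ν := ν) (hmin := hmin) hε0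
    hε hκs (g₁ := fun _ => (0 : ℝ)) (g₂ := fun _ => (1 : ℝ)) measurable_const measurable_const i
  rw [← hP] at hT hTid
  have hbr : ∀ (x : ℕ → Ω × Bool) (a : ℕ), (∑' u, (if (∑ s ∈ Finset.range u,
      (if (x (s + 1)).2 then (1 : ℕ) else 0)) = a then (1 : ℝ) else 0) * (1 : ℝ))
      = ∑' u, (if (∑ s ∈ Finset.range u, (if (x (s + 1)).2 then (1 : ℕ) else 0)) = a
        then (1 : ℝ) else 0) := fun x a => tsum_congr fun u => mul_one _
  have hN := hT.comp (fun _ => Prod.snd) (fun _ => measurable_snd)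
  have hNid := fun i => (hTid i).comp measurable_snd
  simp only [Function.comp_def, hbr, Nat.zero_add] at hN hNid
  obtain ⟨hN1I, -, hN1E, -⟩ := splitChain_tourLength_moments κs μs (κ := κ) (ν := ν) (hmin := hmin)
    hε0 hε hκs 0
  rw [← hP] at hN1I hN1E
  simp only [Nat.zero_add] at hN1I hN1E
  have hslln := strong_law_ae_real (fun (i : ℕ) (x : ℕ → Ω × Bool) => ∑' u,
      (if (∑ s ∈ Finset.range u, (if (x (s + 1)).2 then (1 : ℕ) else 0)) = i + 1
        then (1 : ℝ) else 0)) hN1I (fun i j hij => hN.indepFun hij) hNid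
  rw [hN1E] at hslln
  exact hslln

/-- **CLT FOR THE CENTRED TOUR SUMS**: `π` invariant, `0 < ε < 1`, `|f| ≤ C` measurable, any initial
law; `Z_{i+1} = ∑' u, 1{K_u = i+1} (f(X_u) − π f)`.  For any real random variable `Y` (on any
auxiliary probability space) with law `N(0, σ²_f / e)`:
`(√R)⁻¹ Σ_{i<R} Z_{i+1} ⇒ Y` in distribution as `R → ∞`.  (The instance argument
`[IsProbabilityMeasure P̂]` is `inferInstance` at every call site; it is a binder only because
instance search does not see through the constant family `fun _ => P̂` that
`TendstoInDistribution` takes.) -/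
theorem splitChain_centredTourSum_clt {π : Measure Ω} [IsProbabilityMeasure π]
    (hπ : Kernel.Invariant κ π) (hε0 : 0 < ε) (hε : ε < 1)
    (hκs : ∀ p, κs p = (ε • ν).map (fun y : Ω => (y, true))
      + ((1 - ε) • Doeblin.residualKernel κ ν ε hmin p.1).map (fun y : Ω => (y, false)))
    {f : Ω → ℝ} (hf : Measurable f) {C : ℝ} (hC : ∀ x, |f x| ≤ C)
    {Ω' : Type*} [MeasurableSpace Ω'] {P' : Measure Ω'} [IsProbabilityMeasure P'] {Y : Ω' → ℝ}
    (hY : HasLaw Y (gaussianReal 0 (((∫ y, (f y - ∫ z, f z ∂π) ^ 2 ∂π)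
      + 2 * ∑' k, ∫ y, (f y - ∫ z, f z ∂π)
        * (kop κ)^[k + 1] (fun y => f y - ∫ z, f z ∂π) y ∂π) / ε.toReal).toNNReal) P')
    [IsProbabilityMeasure (Kernel.trajMeasure (X := fun _ : ℕ => Ω × Bool) μs
      (fun m : ℕ => κs.comap (fun h : (i : ↥(Finset.Iic m)) → Ω × Bool =>
        h ⟨m, Finset.mem_Iic.2 le_rfl⟩) (measurable_pi_apply _)))] :
    TendstoInDistribution (fun (R : ℕ) (x : ℕ → Ω × Bool) =>
        (Real.sqrt R)⁻¹ * ∑ i ∈ Finset.range R, ∑' u, (if (∑ s ∈ Finset.range u,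
          (if (x (s + 1)).2 then (1 : ℕ) else 0)) = i + 1 then (1 : ℝ) else 0)
          * (f (x u).1 - ∫ z, f z ∂π))
      atTop Y (fun _ => Kernel.trajMeasure (X := fun _ : ℕ => Ω × Bool) μs
        (fun m : ℕ => κs.comap (fun h : (i : ↥(Finset.Iic m)) → Ω × Bool =>
          h ⟨m, Finset.mem_Iic.2 le_rfl⟩) (measurable_pi_apply _))) P' := by
  haveI hνt : IsProbabilityMeasure (ν.map (fun y : Ω => (y, true))) :=
    Measure.isProbabilityMeasure_map (measurable_tagCoin true).aemeasurable
  set P := Kernel.trajMeasure (X := fun _ : ℕ => Ω × Bool) μs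
      (fun m : ℕ => κs.comap (fun h : (i : ↥(Finset.Iic m)) → Ω × Bool =>
        h ⟨m, Finset.mem_Iic.2 le_rfl⟩) (measurable_pi_apply _)) with hP
  set Pν := Kernel.trajMeasure (X := fun _ : ℕ => Ω × Bool) (ν.map (fun y : Ω => (y, true)))
      (fun m : ℕ => κs.comap (fun h : (i : ↥(Finset.Iic m)) → Ω × Bool =>
        h ⟨m, Finset.mem_Iic.2 le_rfl⟩) (measurable_pi_apply _)) with hPν
  set c := ∫ z, f z ∂π with hc
  set σ2 := (∫ y, (f y - c) ^ 2 ∂π)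
      + 2 * ∑' k, ∫ y, (f y - c) * (kop κ)^[k + 1] (fun y => f y - c) y ∂π with hσ2
  have he0 : 0 < ε.toReal := ENNReal.toReal_pos hε0.ne' (ne_top_of_lt hε)
  obtain ⟨hg, hCg, -⟩ := centred_observable_bounds π hf hC
  -- the centred tour sums `X i = Z_{i+1}` are i.i.d.
  set X : ℕ → (ℕ → Ω × Bool) → ℝ := fun i x => ∑' u, (if (∑ s ∈ Finset.range u,
      (if (x (s + 1)).2 then (1 : ℕ) else 0)) = i + 1 then (1 : ℝ) else 0) * (f (x u).1 - c)
    with hX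
  have hT := splitChain_tourPairs_iIndepFun κs μs (κ := κ) (ν := ν) (hmin := hmin) hε0 hε hκs
    (g₁ := fun y => f y - c) (g₂ := fun _ => (1 : ℝ)) hg measurable_const
  have hTid := fun i => splitChain_tourPair_identDistrib κs μs (κ := κ) (ν := ν) (hmin := hmin) hε0
    hε hκs (g₁ := fun y => f y - c) (g₂ := fun _ => (1 : ℝ)) hg measurable_const i
  have hT0 := splitChain_tourPair_identDistrib_fresh κs μs (κ := κ) (ν := ν) (hmin := hmin) hε0 hε
    hκs (g₁ := fun y => f y - c) (g₂ := fun _ => (1 : ℝ)) hg measurable_const 0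
  rw [← hP] at hT hTid
  rw [← hP, ← hPν] at hT0
  have hXind : iIndepFun X P := by
    have h := hT.comp (fun _ => Prod.fst) (fun _ => measurable_fst)
    simp only [Function.comp_def] at h
    exact h
  have hXid : ∀ i, IdentDistrib (X i) (X 0) P P := fun i => by
    have h := (hTid i).comp measurable_fst
    simp only [Function.comp_def] at h
    exact h
  have hX0fresh : IdentDistrib (X 0) (fun y : ℕ → Ω × Bool => ∑' u, (if (∑ s ∈ Finset.range u,
      (if (y (s + 1)).2 then (1 : ℕ) else 0)) = 0 then (1 : ℝ) else 0) * (f (y u).1 - c)) P Pν := by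
    have h := hT0.comp measurable_fst
    simp only [Function.comp_def] at h
    exact h
  have hXm : ∀ i, Measurable (X i) := fun i =>
    measurable_tourSum (Ω := Ω) (ψ := fun p _ => f p.1 - c)
      (hg.comp (measurable_fst.comp measurable_fst)) (i + 1)
  -- moments: `E[X 0] = 0`, `Var[X 0] = E_ν̂[Z_0²] = σ²_f / e`
  have hmean : ∫ x, X 0 x ∂P = 0 := by
    rw [hX0fresh.integral_eq, hPν]
    exact (splitChain_fresh_integral_centredTourSum κs (κ := κ) (ν := ν) (hmin := hmin) hπ hε0 hε
      hκs hf hC).2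
  have hsqI : Integrable (fun x => (X 0 x) ^ 2) P := by
    have h := splitChain_integrable_sq_tourSum κs μs (κ := κ) (ν := ν) (hmin := hmin) hε0 hε hκs hg
      hCg 1
    rw [← hP] at h
    exact h
  have hmem : MemLp (X 0) 2 P := (memLp_two_iff_integrable_sq (hXm 0).aestronglyMeasurable).2 hsqI
  have hvar : Var[X 0; P] = σ2 / ε.toReal := by
    have h2 := (hX0fresh.comp (u := fun a : ℝ => a ^ 2) (measurable_id.pow_const 2)).integral_eq
    simp only [Function.comp_def] at h2
    rw [variance_of_integral_eq_zero (hXm 0).aemeasurable hmean, h2, eq_div_iff he0.ne', mul_comm,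
      hPν]
    exact splitChain_fresh_sq_centredTourSum_eq_greenKubo κs (κ := κ) (ν := ν) (hmin := hmin) hπ
      hε0 hε hκs hf hC
  have hY' : HasLaw Y (gaussianReal 0 (Var[X 0; P]).toNNReal) P' := by rw [hvar]; exact hY
  have hclt := tendstoInDistribution_inv_sqrt_mul_sum_sub hY' hmem hXind hXid
  refine hclt.congr (fun n => ae_of_all _ fun x => ?_) EventuallyEq.rfl
  simp only [hX] at hmean ⊢
  rw [hmean, mul_zero, sub_zero]

/-- **THE REGENERATIVE ESTIMATOR OBEYS THE CENTRAL LIMIT THEOREM WITH THE GREEN–KUBO VARIANCE.**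
`π` invariant, `κ(x, ·) ≥ ε ν` with `0 < ε < 1`, `|f| ≤ C` measurable, ANY initial law; `R` tours,
`Â_R = Σ_{i=1}^R Y_i / Σ_{i=1}^R N_i`, `σ²_f = ∫ f̄² dπ + 2 ∑' k, ∫ f̄ (kop κ)^[k+1] f̄ dπ`.  For any
real random variable `Y` (on any auxiliary probability space) with law `N(0, e · σ²_f)`:
`√R · (Â_R − π(f)) ⇒ Y` in distribution as `R → ∞`.  (Instance argument: see
`splitChain_centredTourSum_clt`.) -/
theorem regenerative_estimator_clt {π : Measure Ω} [IsProbabilityMeasure π]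
    (hπ : Kernel.Invariant κ π) (hε0 : 0 < ε) (hε : ε < 1)
    (hκs : ∀ p, κs p = (ε • ν).map (fun y : Ω => (y, true))
      + ((1 - ε) • Doeblin.residualKernel κ ν ε hmin p.1).map (fun y : Ω => (y, false)))
    {f : Ω → ℝ} (hf : Measurable f) {C : ℝ} (hC : ∀ x, |f x| ≤ C)
    {Ω' : Type*} [MeasurableSpace Ω'] {P' : Measure Ω'} [IsProbabilityMeasure P'] {Y : Ω' → ℝ}
    (hY : HasLaw Y (gaussianReal 0 (ε.toReal * ((∫ y, (f y - ∫ z, f z ∂π) ^ 2 ∂π)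
      + 2 * ∑' k, ∫ y, (f y - ∫ z, f z ∂π)
        * (kop κ)^[k + 1] (fun y => f y - ∫ z, f z ∂π) y ∂π)).toNNReal) P')
    [IsProbabilityMeasure (Kernel.trajMeasure (X := fun _ : ℕ => Ω × Bool) μs
      (fun m : ℕ => κs.comap (fun h : (i : ↥(Finset.Iic m)) → Ω × Bool =>
        h ⟨m, Finset.mem_Iic.2 le_rfl⟩) (measurable_pi_apply _)))] :
    TendstoInDistribution (fun (R : ℕ) (x : ℕ → Ω × Bool) =>
        Real.sqrt R * ((∑ i ∈ Finset.range R, ∑' u, (if (∑ s ∈ Finset.range u,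
            (if (x (s + 1)).2 then (1 : ℕ) else 0)) = i + 1 then (1 : ℝ) else 0) * f (x u).1)
          / (∑ i ∈ Finset.range R, ∑' u, (if (∑ s ∈ Finset.range u,
            (if (x (s + 1)).2 then (1 : ℕ) else 0)) = i + 1 then (1 : ℝ) else 0))
          - ∫ z, f z ∂π))
      atTop Y (fun _ => Kernel.trajMeasure (X := fun _ : ℕ => Ω × Bool) μs
        (fun m : ℕ => κs.comap (fun h : (i : ↥(Finset.Iic m)) → Ω × Bool =>
          h ⟨m, Finset.mem_Iic.2 le_rfl⟩) (measurable_pi_apply _))) P' := by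
  set P := Kernel.trajMeasure (X := fun _ : ℕ => Ω × Bool) μs
      (fun m : ℕ => κs.comap (fun h : (i : ↥(Finset.Iic m)) → Ω × Bool =>
        h ⟨m, Finset.mem_Iic.2 le_rfl⟩) (measurable_pi_apply _)) with hP
  set c := ∫ z, f z ∂π with hc
  set σ2 := (∫ y, (f y - c) ^ 2 ∂π)
      + 2 * ∑' k, ∫ y, (f y - c) * (kop κ)^[k + 1] (fun y => f y - c) y ∂π with hσ2
  have he0 : 0 < ε.toReal := ENNReal.toReal_pos hε0.ne' (ne_top_of_lt hε)
  have he1 : ε.toReal ≤ 1 :=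
    ENNReal.toReal_le_of_le_ofReal zero_le_one (by rw [ENNReal.ofReal_one]; exact hε.le)
  have h1e : 1 ≤ 1 / ε.toReal := (one_le_div he0).2 he1
  have hσ0 : 0 ≤ σ2 := asymptoticVariance_nonneg_minorised (κ := κ) (ν := ν) hπ hmin hε0 hε hf hC
  -- the rescaled Gaussian `Y / e` has law `N(0, σ²_f / e)`
  have hY₀ : HasLaw (fun ω => ε.toReal⁻¹ * Y ω) (gaussianReal 0 (σ2 / ε.toReal).toNNReal) P' := by
    refine ⟨hY.aemeasurable.const_mul _, ?_⟩
    rw [show (fun ω => ε.toReal⁻¹ * Y ω) = (fun a : ℝ => ε.toReal⁻¹ * a) ∘ Y from rfl,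
      ← AEMeasurable.map_map_of_aemeasurable (measurable_const_mul _).aemeasurable
      hY.aemeasurable, hY.map_eq, gaussianReal_map_const_mul, mul_zero]
    congr 1
    apply NNReal.coe_injective
    rw [NNReal.coe_mul, NNReal.coe_mk, Real.coe_toNNReal _ (mul_nonneg he0.le hσ0),
      Real.coe_toNNReal _ (div_nonneg hσ0 he0.le)]
    field_simp
  -- the CLT for the centred tour sums and the strong law for the tour lengths
  have hcltZ := splitChain_centredTourSum_clt κs μs (κ := κ) (ν := ν) (hmin := hmin) hπ hε0 hε hκs hf
    hC hY₀
  have hWm : ∀ R : ℕ, Measurable fun x : ℕ → Ω × Bool => (∑ i ∈ Finset.range R, ∑' u,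
      (if (∑ s ∈ Finset.range u, (if (x (s + 1)).2 then (1 : ℕ) else 0)) = i + 1
        then (1 : ℝ) else 0)) / R := fun R =>
    (Finset.measurable_sum _ fun i _ => Measurable.tsum fun u =>
      measurable_headCountIndicator u (i + 1)).div_const _
  have hW : TendstoInMeasure P (fun (R : ℕ) (x : ℕ → Ω × Bool) => (∑ i ∈ Finset.range R, ∑' u,
      (if (∑ s ∈ Finset.range u, (if (x (s + 1)).2 then (1 : ℕ) else 0)) = i + 1
        then (1 : ℝ) else 0)) / R) atTop (fun _ => 1 / ε.toReal) :=
    tendstoInMeasure_of_tendsto_ae (fun R => (hWm R).aestronglyMeasurable)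
      (splitChain_tourLength_strongLaw κs μs (κ := κ) (ν := ν) (hmin := hmin) hε0 hε hκs)
  -- Slutsky with the continuous map `(a, w) ↦ a / max(w, 1)`
  have hg : Continuous fun p : ℝ × ℝ => p.1 / max p.2 1 :=
    continuous_fst.div (continuous_snd.max continuous_const)
      fun p => (lt_of_lt_of_le one_pos (le_max_right _ _)).ne'
  have hS := hcltZ.continuous_comp_prodMk_of_tendstoInMeasure_const hg hW
    (fun R => (hWm R).aemeasurable)
  -- almost surely every tour starts: identify the two sides pathwise
  have hae := splitChain_ae_tourStart κs μs (κ := κ) (ν := ν) (hmin := hmin) hε0 hε hκs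
  rw [← hP] at hae
  refine hS.congr (fun R => ?_) (ae_of_all _ fun ω => ?_)
  · filter_upwards [hae] with x hx
    rcases Nat.eq_zero_or_pos R with hR | hR
    · subst hR
      simp
    -- every tour `i + 1` is a finite sum of length `≥ 1`
    have hN1 : ∀ i : ℕ, (1 : ℝ) ≤ ∑' u, (if (∑ s ∈ Finset.range u,
        (if (x (s + 1)).2 then (1 : ℕ) else 0)) = i + 1 then (1 : ℝ) else 0) := fun i => by
      obtain ⟨t₀, ht₀, hh₀⟩ := hx i
      obtain ⟨t₁, ht₁, hh₁⟩ := hx (i + 1)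
      exact one_le_tourLength x ht₀ hh₀ ht₁ hh₁
    have hZ : ∀ i : ℕ, (∑' u, (if (∑ s ∈ Finset.range u,
        (if (x (s + 1)).2 then (1 : ℕ) else 0)) = i + 1 then (1 : ℝ) else 0) * (f (x u).1 - c))
        = (∑' u, (if (∑ s ∈ Finset.range u, (if (x (s + 1)).2 then (1 : ℕ) else 0)) = i + 1
            then (1 : ℝ) else 0) * f (x u).1)
          - c * (∑' u, (if (∑ s ∈ Finset.range u, (if (x (s + 1)).2 then (1 : ℕ) else 0)) = i + 1
            then (1 : ℝ) else 0)) := fun i => by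
      obtain ⟨t₁, ht₁, hh₁⟩ := hx (i + 1)
      rw [tourSum_eq_finsetSum (fun p _ => f p.1 - c) x le_rfl ht₁ hh₁,
        tourSum_eq_finsetSum (fun p _ => f p.1) x le_rfl ht₁ hh₁,
        tourLength_eq_finsetSum x le_rfl ht₁ hh₁, Finset.mul_sum, ← Finset.sum_sub_distrib]
      exact Finset.sum_congr rfl fun u _ => by ring
    set SY := ∑ i ∈ Finset.range R, ∑' u, (if (∑ s ∈ Finset.range u,
        (if (x (s + 1)).2 then (1 : ℕ) else 0)) = i + 1 then (1 : ℝ) else 0) * f (x u).1 with hSY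
    set SN := ∑ i ∈ Finset.range R, ∑' u, (if (∑ s ∈ Finset.range u,
        (if (x (s + 1)).2 then (1 : ℕ) else 0)) = i + 1 then (1 : ℝ) else 0) with hSN
    have hSZ : (∑ i ∈ Finset.range R, ∑' u, (if (∑ s ∈ Finset.range u,
        (if (x (s + 1)).2 then (1 : ℕ) else 0)) = i + 1 then (1 : ℝ) else 0) * (f (x u).1 - c))
        = SY - c * SN := by
      rw [Finset.sum_congr rfl fun i _ => hZ i, Finset.sum_sub_distrib, ← Finset.mul_sum]
    have hR0 : (0 : ℝ) < R := Nat.cast_pos.2 hR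
    have hRS : (R : ℝ) ≤ SN := by
      calc (R : ℝ) = ∑ i ∈ Finset.range R, (1 : ℝ) := by simp
        _ ≤ SN := Finset.sum_le_sum fun i _ => hN1 i
    have hSN0 : 0 < SN := hR0.trans_le hRS
    have hW1 : 1 ≤ SN / R := (one_le_div hR0).2 hRS
    have hsqne : Real.sqrt R ≠ 0 := (Real.sqrt_pos.2 hR0).ne'
    have hSNne : SN ≠ 0 := hSN0.ne'
    have hRne : (R : ℝ) ≠ 0 := hR0.ne'
    show (Real.sqrt R)⁻¹ * (∑ i ∈ Finset.range R, ∑' u, (if (∑ s ∈ Finset.range u,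
        (if (x (s + 1)).2 then (1 : ℕ) else 0)) = i + 1 then (1 : ℝ) else 0) * (f (x u).1 - c))
        / max (SN / R) 1 = Real.sqrt R * (SY / SN - c)
    rw [max_eq_left hW1, hSZ]
    have h1 : (Real.sqrt R)⁻¹ * (SY - c * SN) / (SN / R)
        = ((R : ℝ) / Real.sqrt R) * ((SY - c * SN) / SN) := by
      field_simp
    rw [h1, Real.div_sqrt, sub_div, mul_div_cancel_right₀ _ hSNne]
  · show (ε.toReal⁻¹ * Y ω) / max (1 / ε.toReal) 1 = Y ω
    rw [max_eq_left h1e]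
    field_simp

end CLT

end Summit.Ventures.LatticeQCDFlow.Scoring

end
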